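import Mathlib
import HarnessLib
import Summits.Langlands.Langlands.Statement
import Summits.Langlands.Langlands.Theorems.SkinnerWilesDefectOneEisensteinProModularSeedQuadraticBaseChangeTwist

/-!
# Item `SeedOfQuadraticBaseChange` (stmt-Langlands-15158, route `SkinnerWilesDefectOne`):
# stub S4 of the seed's line `descend-raise-basechange` from `QuadraticBaseChangeGalois` ALONE

The item `SeedOfQuadraticBaseChange : QuadraticBaseChangeGalois → EisensteinProModularSeed` is the
seed crux `EisensteinProModularSeed` (stmt-Langlands-12920) run with its stub S4
(`stub_quadraticBaseChangeTwist`, landed CONDITIONALLY on three named base-change facts in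
`…EisensteinProModularSeedQuadraticBaseChangeTwist`) discharged instead from the promoted crux
`QuadraticBaseChangeGalois` (stmt-Langlands-15156).  This file is exactly that discharge — the
15158-specific delta over 12920: the registered S4 statement (with the hypothesis "`ν` unramified off
`S`" that the landed form carries) proved from the `QuadraticBaseChangeGalois` signature taken
VERBATIM as a hypothesis (so that `hQ : QuadraticBaseChangeGalois` applies by `Iff.rfl`-unfolding once
the route decl renders), with no base-change fact left in its cone.

Proof: `QuadraticBaseChangeGalois` hands over the cuspidal `P` on `GL₂(𝔸_F)` of infinity type
`τ ↦ T(τ|_ℚ) = T.baseChange F` that is Satake–Frobenius compatible with `ρ'|_{Γ_F}` at every `w ∤ p`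
where the latter is unramified (its hypothesis "`ρ'|_{Γ_F}` irreducible" follows from the
irreducibility of `r = ν ⊗ ρ'|_{Γ_F}`, `isIrreducible_of_coe_eq_smul`); then, as in the landed S4,
`πF := P ⊗ (χ ∘ det)` for the finite-order Hecke character `χ` of `ν`
(`exists_heckeCharacter_of_finiteOrder`, class field theory, proved in the tree), the infinity type is
unchanged (`HasArchParameter.twist`) and at `v ∉ S` the twist formula `satakeFrobCompatibleAt_twist`
matches `r(Frob_v) = ν(Frob_v) ρ'(Frob_v)`.
-/

set_option linter.dupNamespace false -- project-wide option (lakefile weak.linter.dupNamespace); `Summit.Langlands.Langlands` is the mandated namespace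

noncomputable section

open scoped MatrixGroups Matrix NumberField Polynomial Classical
open NumberField IsDedekindDomain Field Polynomial Filter
open Literature.NumberTheory.Automorphic Literature.NumberTheory.GaloisRepresentations

namespace Summit.Langlands.Langlands.Theorems.SkinnerWilesDefectOne.SeedOfQuadraticBaseChange

open Summit.Langlands.Langlands.Theorems.SkinnerWilesDefectOne.EisensteinProModularSeed

/-- **Stub S4 `stub_quadraticBaseChangeTwist` from `QuadraticBaseChangeGalois` alone** (the rewire of
the seed's line for item `SeedOfQuadraticBaseChange`).  Hypothesis: the signature of the route crux
`QuadraticBaseChangeGalois` (stmt-Langlands-15156) verbatim — Langlands' quadratic base change for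
`GL₂` from `ℚ` to a quadratic `F` in Galois-compatible form.  Conclusion: the registered S4 — for `F`
imaginary quadratic, `π` cuspidal on `GL₂(𝔸_ℚ)` with a regular L-algebraic infinity type `T`,
`ρ' : Γ_ℚ → GL₂(ℚ̄_p)` Satake–Frobenius compatible with `π` almost everywhere, `ν : Γ_F → ℚ̄_pˣ`
continuous of finite order, `r = ν ⊗ ρ'|_{Γ_F}` irreducible, `S ⊇ {v ∣ p}` finite with `r` and `ν`
unramified off `S`, there is a cuspidal `πF` on `GL₂(𝔸_F)` with a regular L-algebraic infinity type and
`SatakeFrobCompatibleAt ι πF r v` at every `v ∉ S`. [folklore] -/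
theorem stub_quadraticBaseChangeTwist_of_quadraticBaseChangeGalois
    (hQ : ∀ (F : Type) [Field F] [NumberField F], Module.finrank ℚ F = 2 →
      ∀ (p : ℕ) [Fact p.Prime]
        (hcptQ : Literature.NumberTheory.Automorphic.isCompact_glFiniteIntegralLevel 2 ℚ)
        (hcptF : Literature.NumberTheory.Automorphic.isCompact_glFiniteIntegralLevel 2 F)
        (ι : PadicAlgCl p ≃+* ℂ)
        (π : Literature.NumberTheory.Automorphic.CuspidalAutomorphicRepData 2 ℚ hcptQ)
        (T : Literature.NumberTheory.Automorphic.InfinityType ℚ 2),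
      π.1.HasInfinityType T → T.IsLAlgebraic → T.IsRegular →
      ∀ (ρ : Literature.NumberTheory.GaloisRepresentations.FramedGaloisRep ℚ (PadicAlgCl p) 2),
      (∀ᶠ v in Filter.cofinite, Summit.Langlands.SatakeFrobCompatibleAt ι π.1 ρ v) →
      (ρ.restrictField F).toGaloisRep.IsIrreducible →
      ∃ P : Literature.NumberTheory.Automorphic.CuspidalAutomorphicRepData 2 F hcptF,
        P.1.HasInfinityType (fun τ => T (τ.comp (algebraMap ℚ F))) ∧
        ∀ w : IsDedekindDomain.HeightOneSpectrum (NumberField.RingOfIntegers F),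
          (p : NumberField.RingOfIntegers F) ∉ w.asIdeal → (ρ.restrictField F).IsUnramifiedAt w →
          Summit.Langlands.SatakeFrobCompatibleAt ι P.1 (ρ.restrictField F) w) :
    ∀ (F : Type) [Field F] [NumberField F], NumberField.IsTotallyComplex F → Module.finrank ℚ F = 2 →
      ∀ (p : ℕ) [Fact p.Prime] (hcptQ : Literature.NumberTheory.Automorphic.isCompact_glFiniteIntegralLevel 2 ℚ) (ι : PadicAlgCl p ≃+* ℂ)
        (π : Literature.NumberTheory.Automorphic.CuspidalAutomorphicRepData 2 ℚ hcptQ) (T : Literature.NumberTheory.Automorphic.InfinityType ℚ 2),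
      π.1.HasInfinityType T → T.IsLAlgebraic → T.IsRegular →
      ∀ (ρ' : Literature.NumberTheory.GaloisRepresentations.FramedGaloisRep ℚ (PadicAlgCl p) 2),
      (∀ᶠ w in Filter.cofinite, Summit.Langlands.SatakeFrobCompatibleAt ι π.1 ρ' w) →
      ∀ (ν : Field.absoluteGaloisGroup F →ₜ* (PadicAlgCl p)ˣ), (∃ n : ℕ, 0 < n ∧ ∀ σ, ν σ ^ n = 1) →
      ∀ (r : Literature.NumberTheory.GaloisRepresentations.FramedGaloisRep F (PadicAlgCl p) 2),
      (∀ σ, (r σ).val = ((ν σ : (PadicAlgCl p)ˣ) : PadicAlgCl p) • (ρ' (Literature.NumberTheory.GaloisRepresentations.absGaloisRestrict ℚ F σ)).val) →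
      r.toGaloisRep.IsIrreducible →
      ∀ (S : Set (IsDedekindDomain.HeightOneSpectrum (NumberField.RingOfIntegers F))), S.Finite →
      (∀ v : IsDedekindDomain.HeightOneSpectrum (NumberField.RingOfIntegers F), (p : NumberField.RingOfIntegers F) ∈ v.asIdeal → v ∈ S) →
      (∀ v ∉ S, r.IsUnramifiedAt v) →
      (∀ v ∉ S, ∀ 𝔓 ∈ v.primesAbove, ∀ σ ∈ 𝔓.inertia (Field.absoluteGaloisGroup F), ν σ = 1) →
      ∀ hcptF : Literature.NumberTheory.Automorphic.isCompact_glFiniteIntegralLevel 2 F,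
        ∃ (πF : Literature.NumberTheory.Automorphic.CuspidalAutomorphicRepData 2 F hcptF) (T' : Literature.NumberTheory.Automorphic.InfinityType F 2),
          πF.1.HasInfinityType T' ∧ T'.IsLAlgebraic ∧ T'.IsRegular ∧
          ∀ v ∉ S, Summit.Langlands.SatakeFrobCompatibleAt ι πF.1 r v := by
  intro F _ _ _ hdeg p _ hcptQ ι π T hT hTL hTR ρ' hcompat ν hν r hrν hrirr S _ hSp hSunr hνS hcptF
  -- (1) irreducibility of `ρ'|_{Γ_F}` (from that of `r = ν ⊗ ρ'|_{Γ_F}`)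
  have hρ'F : (ρ'.restrictField F).toGaloisRep.IsIrreducible :=
    isIrreducible_of_coe_eq_smul r (ρ'.restrictField F) id
      (fun σ => ((ν σ : (PadicAlgCl p)ˣ) : PadicAlgCl p))
      (fun σ => by rw [id, FramedGaloisRep.restrictField_apply]; exact hrν σ) hrirr
  -- (2) quadratic base change: the cuspidal `P` of infinity type `T^F`, compatible off `p`
  obtain ⟨P, hPT, hPc⟩ := hQ F hdeg p hcptQ hcptF ι π T hT hTL hTR ρ' hcompat hρ'F
  have hPT' : P.1.HasInfinityType (T.baseChange F) := hPT
  -- (3) the Hecke character `χ` of `ν` and the twist `πF = P ⊗ (χ ∘ det)`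
  obtain ⟨χ, hχ, hχν⟩ := exists_heckeCharacter_of_finiteOrder ι ν hν
  refine ⟨P.twist χ hχ, T.baseChange F, ⟨hPT'.1, ?_⟩, hTL.baseChange, hTR.baseChange,
    fun v hv => ?_⟩
  · rw [CuspidalAutomorphicRepData.twist_val]
    exact AutomorphicRepData.HasArchParameter.twist P.1 χ hχ hPT'.2
  -- (4) compatibility at `v ∉ S`
  have hvp : (p : 𝓞 F) ∉ v.asIdeal := fun h => hv (hSp v h)
  have hρ'v : (ρ'.restrictField F).IsUnramifiedAt v :=
    isUnramifiedAt_restrictField_of_smul ρ' ν r hrν (hSunr v hv) (hνS v hv)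
  obtain ⟨hχv, hνv⟩ := hχν v (hνS v hv)
  have hc : Summit.Langlands.SatakeFrobCompatibleAt ι P.1 (ρ'.restrictField F) v := hPc v hvp hρ'v
  rw [CuspidalAutomorphicRepData.twist_val]
  exact satakeFrobCompatibleAt_twist ι P.1 (ρ'.restrictField F) r hχ
    (fun σ => ((ν σ : (PadicAlgCl p)ˣ) : PadicAlgCl p))
    (fun σ => by rw [FramedGaloisRep.restrictField_apply]; exact hrν σ) hχv hνv (hSunr v hv) hc

end Summit.Langlands.Langlands.Theorems.SkinnerWilesDefectOne.SeedOfQuadraticBaseChange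

end
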